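import Mathlib.LinearAlgebra.Matrix.Determinant.Basic
import Literature.NumberTheory.EllipticCurves.GeomPointReduction
import Literature.NumberTheory.EllipticCurves.CanonicalPAdicHeightParallelogramProofs
import HarnessLib

/-!
# The Mazur–Tate tame height pairing at a good prime and the tame regulator at Kolyvagin primes

Topic `NumberTheory/EllipticCurves`.  Mazur–Tate (*Refined conjectures of the "Birch and
Swinnerton-Dyer type"*, Duke Math. J. 54 (1987), Ch. II §3, pp. 731–734) attach to an elliptic curve
`E/ℚ` and a square-free `M` prime to the conductor a *canonical height pairing with values in
`G_M = (ℤ/M)^× / ±1`*, `⟨ , ⟩_S : E(ℚ) × E_S(ℚ) → G_M`, where `E_S(ℚ) ⊂ E(ℚ)` is the finite-index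
subgroup of points reducing to `Õ` at the primes `ℓ ∣ M` (the *tamely ramified trivialisation*
at `ℓ`) and lying on the identity component at the bad primes (Tan, Ann. Inst. Fourier 45 (1995),
§2.1 (L3)–(L4); Darmon, Contemp. Math. 165 (1994), §2.2; Burns–Kurihara–Sano, arXiv:2103.11535,
§2.2).  Its *Mazur–Tate regulator* is the discriminant `det(⟨x_i, x_j⟩)` ([BKS] (6)); Conjecture 4
of [MT87] (= [BKS] Conj. 2.3) relates it to the leading coefficient of the Mazur–Tate modular
element `θ_M`.  At a prime `ℓ` the pairing is COMPUTED (Mazur–Tate, loc. cit., p. 747, "the function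
`g`"; Portillo-Bobadilla, arXiv:1709.01204, §3.2) by the formula in denominators of
`x`-coordinates recalled in §3 below.

At a *Kolyvagin prime* `ℓ` for `p^k` (`ℓ ≡ 1`, `a_ℓ ≡ ℓ + 1 (mod p^k)`) the `p`-part of the
story is carried by the *localisation* `E(ℚ) → Ẽ(𝔽_ℓ) ⊗ ℤ/p^k ≅ ℤ/p^k` (Kurihara, *The structure of
Selmer groups of elliptic curves and modular symbols* (2014), §1.2, Thm. 1.2.3: "`⊕_{ℓ∣m} E(ℚ_ℓ) ⊗
ℤ/p^N ≃ (ℤ/p^N)^{ε(m)}`", §3.3 the maps `φ_ℓ`), the identification with `ℤ/p^k` being a CHOICE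
(a generator of the cyclic group `Ẽ(𝔽_ℓ) ⊗ ℤ/p^k`); determinants of such "tame logarithms" of a
basis of `E(ℚ)` are well defined up to units of `ℤ/p^k`.

## Contents

* §1 `reductionAtPrime`, `reducePointAt`, **`reductionHomAt W ℓ hΔ : E(ℚ) →+ Ẽ(k_ℓ)`** — reduction
  of rational points of a `ℤ`-integral `W/ℚ` modulo a prime `ℓ` of good reduction as a group
  homomorphism (Silverman, *AEC* VII.2.1; the tree's `WeierstrassCurve.reducePoint` for the local
  model `W.localModel ℓ` over `ℤ_(ℓ)`, whose base change to `ℚ` is `W` definitionally), with kernel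
  `E(ℚ) ∩ E₁(ℚ_ℓ) = W.kernelOfReductionAt ℓ` (`reductionHomAt_eq_zero_iff`), and
  `isUnit_Δ_localModel_of_not_dvd` (good reduction at `ℓ ∤ Δ_min`).
* §2 `TameTrivialization A m` (a surjection `A →+ ℤ/m` with kernel `mA`, i.e. `A ⊗ ℤ/m ≅ ℤ/m`),
  `TameTrivialization.exists_units_smul` (**two trivialisations differ by a unit**, proved),
  `tameLogarithm`, **`tameRegulator`** `= det (τ_j (red_{ℓ_j} P_i))_{i,j} ∈ ℤ/m` (the localisation
  determinant `Δ(n)`, `n = ℓ_1 ⋯ ℓ_r`), `isUnit_tameRegulator_iff` (**being a unit does not depend on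
  the trivialisations**, proved), `tameRegulator_eq_zero_of_mem_kernel`.
* §3 `xDen`, **`mazurTateG`** (Mazur–Tate's function `g`, squared), the telescoping identities
  `mazurTateG_add_left/right` (proved: the bi-multiplicativity of `g` granted its independence of
  the auxiliary point), **`mazurTateTameSymbol W ℓ P Q P' ∈ ℤ/ℓ`**, **`mazurTateTamePairing W ℓ ψ P Q
  P'`** (its image under a character `ψ : (ℤ/ℓ)^× → ℤ/m`), and the NAMED FACT
  `MazurTate1987_tameSymbol_indep` (independence of the auxiliary point).

## What is NOT here (and why)

* The Tate–Lichtenbaum / Weil pairings on `Ẽ(𝔽_ℓ)` (the Weil pairing is only the named fact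
  `WeierstrassCurve.exists_weilPairing`: no divisors of functions in the tree), hence no CANONICAL
  normalisation of a `TameTrivialization`: statements needing one (exact leading-term congruences)
  must carry the normalising units; unit/vanishing statements are canonical (`isUnit_tameRegulator_iff`).
* The biextension construction of [MT87] Ch. II and the corrected discriminant; bilinearity of
  `mazurTateTameSymbol` on `E(ℚ) × E_S(ℚ)` is recorded only through the named fact.
* `mazurTateG` is the SQUARE of the printed `g` (which uses `d(T) = √(den x(T))`): the printed `g`
  lifts a value of `𝔽_ℓ^× / ±1` to `ℚ^×` and depends on the auxiliary point up to sign; its square is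
  the canonical lift to `𝔽_ℓ^×` (numerically, on 37a1, `ℓ = 11`, `Q = 17P`: the printed `g` takes
  both values `5` and `6 ≡ -5`, its square only `3`).

## References

* [MazurTate1987] B. Mazur, J. Tate, Duke Math. J. 54 (1987) 711–750: Ch. II §3 (pp. 731–734, the
  `S`-pairing), p. 747 (the function `g`), Conj. 4.  (Not held; paywalled, acq-02631.)
* [PortilloBobadilla2019] F. X. Portillo-Bobadilla, Bol. Soc. Mat. Mex. 25 (2019), arXiv:1709.01204:
  §2.1 (local trivialisations (a)–(c), the global pairing, `disc_S`), §3.2 (the formula for `g`).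
* [Tan1995] K.-S. Tan, Ann. Inst. Fourier 45 (1995): §2.1 (L1)–(L5), §2.2 Def. 2.6–2.8.
* [BurnsKuriharaSano2021] D. Burns, M. Kurihara, T. Sano, arXiv:2103.11535: §2.2 ((4)–(6), Conj. 2.3).
* [Kurihara2014] M. Kurihara, in *Iwasawa Theory 2012*, arXiv:1407.2465: §1.2 Thm. 1.2.3, §3.3 (`φ_ℓ`).
* [SilvermanAEC2009] J. H. Silverman, *AEC*, 2nd ed.: VII.2.1, VII.3 (`x = a/d²` on integral models).
-/

noncomputable section

open scoped Classical

open WeierstrassCurve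

namespace Literature.NumberTheory.EllipticCurves

/-! ### §1 Reduction of rational points modulo a prime of good reduction -/

section Reduction

variable (W : WeierstrassCurve ℚ) [W.IsIntegral ℤ] (ℓ : ℕ) [Fact ℓ.Prime]

/-- The reduction `Ẽ = W mod ℓ` of a `ℤ`-integral Weierstrass equation `W/ℚ` at a prime `ℓ`: the
local model `W.localModel ℓ` over `ℤ_(ℓ)` reduced to the residue field `k_ℓ = ℤ_(ℓ)/ℓℤ_(ℓ) ≅ 𝔽_ℓ`
(Silverman, *AEC* VII.2). [folklore] -/
abbrev reductionAtPrime : WeierstrassCurve (IsLocalRing.ResidueField (localIntegers ℓ)) :=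
  (W.localModel ℓ).map (IsLocalRing.residue (localIntegers ℓ))

/-- The reduction map `E(ℚ) → Ẽ(k_ℓ)`, `P ↦ P̃`, on rational points of a `ℤ`-integral `W/ℚ` (the
tree's `WeierstrassCurve.reducePoint` for the local model at `ℓ`, whose base change to `ℚ` is `W`
definitionally: `O ↦ Õ`, points with `ℓ ∣ den x` go to `Õ`, `ℓ`-integral points with nonsingular
reduction go to `(x̄, ȳ)`, the rest to the junk value `Õ`). Silverman, *AEC* VII.2.
[cite: SilvermanAEC2009, VII.2 (the reduction map, PDF pp. 166–167)] -/
def reducePointAt (P : W.toAffine.Point) : (reductionAtPrime W ℓ).toAffine.Point :=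
  WeierstrassCurve.reducePoint (K := ℚ) (W.localModel ℓ) P

/-- `Õ` is the reduction of `O`. [folklore] -/
@[simp] theorem reducePointAt_zero : reducePointAt W ℓ 0 = 0 := rfl

variable {W ℓ} in
/-- Points of `E(ℚ) ∩ E₁(ℚ_ℓ)` reduce to `Õ`. [folklore] -/
theorem reducePointAt_eq_zero_of_mem {P : W.toAffine.Point} (hP : P ∈ W.kernelOfReductionAt ℓ) :
    reducePointAt W ℓ P = 0 :=
  WeierstrassCurve.ReducesToZero.reducePoint_eq_zero hP

/-- **Good reduction at `ℓ`**: for a globally minimal `W/ℚ` and a prime `ℓ ∤ Δ_W` the discriminant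
of the local model at `ℓ` is a unit of `ℤ_(ℓ)`. Silverman, *AEC* VII.5.1(a). [folklore] -/
theorem isUnit_Δ_localModel_of_not_dvd [W.IsGloballyMinimal]
    (hΔ : ¬ (ℓ : ℤ) ∣ minimalDiscriminantInt W) : IsUnit (W.localModel ℓ).Δ := by
  rw [(integers_localIntegers ℓ).isUnit_iff_valuation_eq_one]
  have h1 : algebraMap (localIntegers ℓ) ℚ (W.localModel ℓ).Δ = W.Δ := by
    rw [show algebraMap (localIntegers ℓ) ℚ (W.localModel ℓ).Δ =
      ((W.localModel ℓ).baseChange ℚ).Δ from ((W.localModel ℓ).map_Δ _).symm]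
    rfl
  rw [h1, ← cast_minimalDiscriminantInt, ratAdicValuation_apply, ← NNReal.coe_eq_one, coe_nnnorm,
    Rat.cast_intCast]
  exact le_antisymm (Padic.norm_int_le_one _)
    (not_lt.mp fun h => hΔ (Padic.norm_intCast_lt_one_iff.mp h))

/-- **The reduction homomorphism `E(ℚ) →+ Ẽ(k_ℓ)` at a prime of good reduction** (Silverman,
*AEC* VII.2.1: reduction is a homomorphism on `E₀`, and `E₀ = E` when `Δ` is an `ℓ`-adic unit):
`reducePointAt` bundled, through the tree's `WeierstrassCurve.reducePoint_add` for the local model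
over the valuation ring `ℤ_(ℓ)` of `ℚ`. [cite: SilvermanAEC2009, VII.2 Prop. 2.1 (PDF p. 167)] -/
def reductionHomAt (hΔ : IsUnit (W.localModel ℓ).Δ) :
    W.toAffine.Point →+ (reductionAtPrime W ℓ).toAffine.Point where
  toFun := reducePointAt W ℓ
  map_zero' := rfl
  map_add' P Q := by
    have h := WeierstrassCurve.reducePoint_add (integers_localIntegers ℓ)
      (hasNonsingularReduction_of_isUnit_Δ (integers_localIntegers ℓ) hΔ P)
      (hasNonsingularReduction_of_isUnit_Δ (integers_localIntegers ℓ) hΔ Q)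
    unfold reducePointAt
    convert h using 2
    exact point_add_irrel _ _ P Q

variable {W ℓ}

/-- Unfolding `reductionHomAt`. [folklore] -/
@[simp] theorem reductionHomAt_apply (hΔ : IsUnit (W.localModel ℓ).Δ) (P : W.toAffine.Point) :
    reductionHomAt W ℓ hΔ P = reducePointAt W ℓ P := rfl

/-- **The kernel of reduction is `E(ℚ) ∩ E₁(ℚ_ℓ)`** (Silverman, *AEC* VII.2.1: exactness of
`0 → E₁ → E₀ → Ẽ`): `P̃ = Õ` iff `P ∈ W.kernelOfReductionAt ℓ` (`P = O` or `ℓ ∣ den x(P)`).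
[cite: SilvermanAEC2009, VII.2 Prop. 2.1 (PDF p. 167)] -/
theorem reductionHomAt_eq_zero_iff (hΔ : IsUnit (W.localModel ℓ).Δ) (P : W.toAffine.Point) :
    reductionHomAt W ℓ hΔ P = 0 ↔ P ∈ W.kernelOfReductionAt ℓ :=
  WeierstrassCurve.reducePoint_eq_zero_iff (integers_localIntegers ℓ)
    (hasNonsingularReduction_of_isUnit_Δ (integers_localIntegers ℓ) hΔ P)

end Reduction

/-! ### §2 Tame trivialisations, tame logarithms and the tame regulator -/

/-- A **trivialisation of `A ⊗ ℤ/m`**: an additive surjection `τ : A → ℤ/m` whose kernel is exactly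
`mA`, i.e. an isomorphism `A/mA ≅ ℤ/m` (it exists iff `A/mA` is cyclic of order `m`, and is then
unique up to a unit of `ℤ/m`, `exists_units_smul`).  For `A = Ẽ(𝔽_ℓ)`, `m = p^k` at a Kolyvagin
prime `ℓ` this is the choice of a generator by which `E(ℚ_ℓ) ⊗ ℤ/p^N ≅ Ẽ(𝔽_ℓ) ⊗ ℤ/p^N` is
identified with `ℤ/p^N` (Kurihara 2014, §1.2, Thm. 1.2.3: "`⊕_{ℓ∣m} E(ℚ_ℓ) ⊗ ℤ/p^N ≃
(ℤ/p^N)^{ε(m)}`"). [cite: Kurihara2014, §1.2 Thm. 1.2.3 and §3.3] -/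
structure TameTrivialization (A : Type*) [AddCommGroup A] (m : ℕ) where
  /-- The surjection `A → ℤ/m`. -/
  toAddMonoidHom : A →+ ZMod m
  /-- It is onto. -/
  surjective : Function.Surjective toAddMonoidHom
  /-- Its kernel is exactly `mA`. -/
  map_eq_zero_iff : ∀ a, toAddMonoidHom a = 0 ↔ ∃ b : A, m • b = a

namespace TameTrivialization

variable {A : Type*} [AddCommGroup A] {m : ℕ}

/-- A trivialisation kills `mA`. [folklore] -/
theorem map_nsmul (τ : TameTrivialization A m) (b : A) : τ.toAddMonoidHom (m • b) = 0 :=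
  (τ.map_eq_zero_iff _).mpr ⟨b, rfl⟩

/-- One trivialisation is a multiple of any other. [folklore] -/
theorem exists_mul (τ τ' : TameTrivialization A m) :
    ∃ u : ZMod m, ∀ a, τ'.toAddMonoidHom a = u * τ.toAddMonoidHom a := by
  obtain ⟨a₀, ha₀⟩ := τ.surjective 1
  refine ⟨τ'.toAddMonoidHom a₀, fun a => ?_⟩
  obtain ⟨k, hk⟩ := ZMod.intCast_surjective (τ.toAddMonoidHom a)
  -- `a - k • a₀ ∈ ker τ = mA ⊆ ker τ'`
  have hker : τ.toAddMonoidHom (a - k • a₀) = 0 := by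
    rw [map_sub, map_zsmul, ha₀, ← hk, zsmul_eq_mul, mul_one, sub_self]
  obtain ⟨b, hb⟩ := (τ.map_eq_zero_iff _).mp hker
  have hker' : τ'.toAddMonoidHom (a - k • a₀) = 0 := by rw [← hb]; exact τ'.map_nsmul b
  rw [map_sub, map_zsmul, sub_eq_zero] at hker'
  rw [hker', ← hk, zsmul_eq_mul, mul_comm]

/-- **Two trivialisations of `A ⊗ ℤ/m` differ by a unit of `ℤ/m`.** [folklore] -/
theorem exists_units_smul (τ τ' : TameTrivialization A m) :
    ∃ u : (ZMod m)ˣ, ∀ a, τ'.toAddMonoidHom a = u * τ.toAddMonoidHom a := by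
  obtain ⟨u, hu⟩ := exists_mul τ τ'
  obtain ⟨v, hv⟩ := exists_mul τ' τ
  obtain ⟨a₀, ha₀⟩ := τ.surjective 1
  have h1 : v * u = 1 := by
    have := hv a₀
    rwa [hu a₀, ha₀, mul_one, eq_comm] at this
  exact ⟨(IsUnit.of_mul_eq_one_right v h1).unit, hu⟩

end TameTrivialization

section Regulator

variable (W : WeierstrassCurve ℚ) [W.IsIntegral ℤ]

/-- The **tame logarithm** `[P]_ℓ ∈ ℤ/m` of a rational point at the prime `ℓ` with respect to a
trivialisation `τ` of `Ẽ(k_ℓ) ⊗ ℤ/m`: the coordinate of the reduction `P̃` (Kurihara's localisation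
`E(ℚ) → E(ℚ_ℓ) ⊗ ℤ/p^N ≅ ℤ/p^N`, 2014, §1.2–§3.3). [cite: Kurihara2014, §1.2 Thm. 1.2.3 and §3.3] -/
def tameLogarithm (ℓ : ℕ) [Fact ℓ.Prime] {m : ℕ}
    (τ : TameTrivialization (reductionAtPrime W ℓ).toAffine.Point m) (P : W.toAffine.Point) :
    ZMod m :=
  τ.toAddMonoidHom (reducePointAt W ℓ P)

variable {W} in
/-- A point of `E(ℚ) ∩ E₁(ℚ_ℓ)` has tame logarithm `0`. [folklore] -/
theorem tameLogarithm_eq_zero_of_mem (ℓ : ℕ) [Fact ℓ.Prime] {m : ℕ}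
    (τ : TameTrivialization (reductionAtPrime W ℓ).toAffine.Point m) {P : W.toAffine.Point}
    (hP : P ∈ W.kernelOfReductionAt ℓ) : tameLogarithm W ℓ τ P = 0 := by
  rw [tameLogarithm, reducePointAt_eq_zero_of_mem hP, map_zero]

variable {r : ℕ} (m : ℕ) (ℓ : Fin r → ℕ) [hℓ : ∀ j, Fact (ℓ j).Prime]

/-- The **tame regulator** (localisation determinant) of the points `P_1, …, P_r ∈ E(ℚ)` at the
primes `ℓ_1, …, ℓ_r` with respect to trivialisations `τ_j` of `Ẽ(𝔽_{ℓ_j}) ⊗ ℤ/m`: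
`det ([P_i]_{ℓ_j})_{i,j} ∈ ℤ/m`, the determinant of the matrix of tame logarithms — the matrix of
the localisation map `E(ℚ) ⊗ ℤ/p^N → ⊕_{ℓ∣n} E(ℚ_ℓ) ⊗ ℤ/p^N ≃ (ℤ/p^N)^r` of Kurihara (2014,
Thm. 1.2.3, `s_m`) on the `P_i`; for `n = ℓ_1⋯ℓ_r` a product of Kolyvagin primes and a basis `(P_i)`
of `E(ℚ)/tors` it is a unit iff that map is an isomorphism on the span.  Well defined up to a unit
of `ℤ/m` (`isUnit_tameRegulator_iff`). [cite: Kurihara2014, §1.2 Thm. 1.2.3] -/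
def tameRegulator (τ : ∀ j, TameTrivialization (reductionAtPrime W (ℓ j)).toAffine.Point m)
    (P : Fin r → W.toAffine.Point) : ZMod m :=
  Matrix.det (Matrix.of fun i j => tameLogarithm W (ℓ j) (τ j) (P i))

variable {W m ℓ}

/-- Rescaling the trivialisations rescales the tame regulator by the product of the scalars.
[folklore] -/
theorem tameRegulator_units_smul
    (τ τ' : ∀ j, TameTrivialization (reductionAtPrime W (ℓ j)).toAffine.Point m) (u : Fin r → ZMod m)
    (hu : ∀ j a, (τ' j).toAddMonoidHom a = u j * (τ j).toAddMonoidHom a)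
    (P : Fin r → W.toAffine.Point) :
    tameRegulator W m ℓ τ' P = (∏ j, u j) * tameRegulator W m ℓ τ P := by
  rw [tameRegulator, tameRegulator, ← Matrix.det_mul_row]
  congr 1
  ext i j
  simp only [Matrix.of_apply, tameLogarithm, hu]

/-- **Being a unit is independent of the trivialisations**: any two families of trivialisations
differ by units (`TameTrivialization.exists_units_smul`), which rescale the determinant by a unit.
[folklore] -/
theorem isUnit_tameRegulator_iff
    (τ τ' : ∀ j, TameTrivialization (reductionAtPrime W (ℓ j)).toAffine.Point m)
    (P : Fin r → W.toAffine.Point) :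
    IsUnit (tameRegulator W m ℓ τ' P) ↔ IsUnit (tameRegulator W m ℓ τ P) := by
  choose u hu using fun j => (τ j).exists_units_smul (τ' j)
  rw [tameRegulator_units_smul τ τ' (fun j => (u j : ZMod m)) hu P,
    IsUnit.mul_iff, and_iff_right]
  exact IsUnit.prod_univ_iff.mpr fun j => (u j).isUnit

/-- A point lying in `E₁(ℚ_{ℓ_j})` for every `j` kills the tame regulator (its row of tame
logarithms vanishes) — the points of Mazur–Tate's `E_S(ℚ)` are invisible to it. [folklore] -/
theorem tameRegulator_eq_zero_of_mem_kernel
    (τ : ∀ j, TameTrivialization (reductionAtPrime W (ℓ j)).toAffine.Point m)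
    (P : Fin r → W.toAffine.Point) {i : Fin r} (hi : ∀ j, P i ∈ W.kernelOfReductionAt (ℓ j)) :
    tameRegulator W m ℓ τ P = 0 :=
  Matrix.det_eq_zero_of_row_eq_zero i fun j => by
    rw [Matrix.of_apply, tameLogarithm_eq_zero_of_mem _ _ (hi j)]

end Regulator

/-! ### §3 Mazur–Tate's function `g` and the tame symbol -/

section MazurTate

variable {V : WeierstrassCurve ℚ}

/-- The denominator `den x(T)` of the `x`-coordinate of a rational point (`= d(T)²` with `d(T)` the
integer of Mazur–Tate and Portillo-Bobadilla when the equation is integral, Silverman *AEC* VII.3: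
`x = a/d²`, `y = b/d³`); junk value `1` at `O`. [folklore] -/
def xDen : V.toAffine.Point → ℕ
  | 0 => 1
  | .some x _ _ => x.den

/-- `den x(O) := 1`. [folklore] -/
@[simp] theorem xDen_zero : xDen (0 : V.toAffine.Point) = 1 := rfl

/-- `den x(x, y) = den x`. [folklore] -/
@[simp] theorem xDen_some {x y : ℚ} (h : V.toAffine.Nonsingular x y) : xDen (.some x y h) = x.den :=
  rfl

/-- Denominators are positive. [folklore] -/
theorem xDen_pos (T : V.toAffine.Point) : 0 < xDen T := by
  rcases T with _ | ⟨x, y, h⟩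
  · exact Nat.one_pos
  · exact x.den_pos

/-- `den x(-T) = den x(T)`. [folklore] -/
@[simp] theorem xDen_neg (T : V.toAffine.Point) : xDen (-T) = xDen T := by
  rcases T with _ | ⟨x, y, h⟩
  · rfl
  · rw [Affine.Point.neg_some]; rfl

/-- **Mazur–Tate's function `g` (squared).**  For rational points `P, Q` and an auxiliary point `P'`,
`g²(P, Q; P') = den x(P'+P) · den x(P'+Q) / (den x(P') · den x(P'+P+Q)) ∈ ℚ_{>0}` — the square of
`g(P, Q, P', ℓ) = d(P'+P) d(P'+Q) / (d(P') d(P'+P+Q))`, `d(T) = √(den x(T))`, of Mazur–Tate (1987),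
p. 747, as printed by Portillo-Bobadilla (2019), §3.2 (there with `Q = Q_p = n_p·Q₀`).  For `Q`
reducing to `Õ` modulo a good prime `ℓ` and `P', P' + P` not doing so it is an `ℓ`-adic unit whose
residue is (the square of) the Mazur–Tate tame height `⟨P, Q⟩` at `ℓ` (`mazurTateTameSymbol`).
[cite: MazurTate1987, Ch. II §3 (pp. 731–734) and p. 747 (the function g)]
[cite: PortilloBobadilla2019, §3.2 (the formula for g)] -/
def mazurTateG (P Q P' : V.toAffine.Point) : ℚ :=
  (xDen (P' + P) * xDen (P' + Q) : ℚ) / (xDen P' * xDen (P' + P + Q))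

/-- **Telescoping in the first argument**: `g²(P₁ + P₂, Q; P') = g²(P₁, Q; P') · g²(P₂, Q; P' + P₁)`
— an identity of positive rationals; granted the independence of the auxiliary point
(`MazurTate1987_tameSymbol_indep`) it is the multiplicativity of the Mazur–Tate pairing in `P`
(Portillo-Bobadilla 2019, §3.2, "`ĝ` is bi-multiplicative"). [folklore] -/
theorem mazurTateG_add_left (P₁ P₂ Q P' : V.toAffine.Point) :
    mazurTateG (P₁ + P₂) Q P' = mazurTateG P₁ Q P' * mazurTateG P₂ Q (P' + P₁) := by
  simp only [mazurTateG, ← add_assoc]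
  have h1 := xDen_pos P'
  have h2 := xDen_pos (P' + P₁)
  have h3 := xDen_pos (P' + P₁ + Q)
  have h4 := xDen_pos (P' + P₁ + P₂ + Q)
  field_simp

/-- **Telescoping in the second argument**: `g²(P, Q₁ + Q₂; P') = g²(P, Q₁; P') · g²(P, Q₂; P' + Q₁)`.
[folklore] -/
theorem mazurTateG_add_right (P Q₁ Q₂ P' : V.toAffine.Point) :
    mazurTateG P (Q₁ + Q₂) P' = mazurTateG P Q₁ P' * mazurTateG P Q₂ (P' + Q₁) := by
  simp only [mazurTateG]
  rw [show P' + P + (Q₁ + Q₂) = P' + Q₁ + P + Q₂ by abel, show P' + P + Q₁ = P' + Q₁ + P by abel,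
    ← add_assoc]
  have h1 := xDen_pos P'
  have h2 := xDen_pos (P' + Q₁)
  have h3 := xDen_pos (P' + Q₁ + P)
  have h4 := xDen_pos (P' + Q₁ + P + Q₂)
  field_simp

variable (V) in
/-- **The Mazur–Tate tame symbol at `ℓ`** (square of the tame canonical height of Mazur–Tate 1987,
Ch. II §3, at a prime `ℓ` of good reduction, in the explicit form of loc. cit. p. 747 /
Portillo-Bobadilla 2019 §3.2): for `P ∈ E(ℚ)`, `Q ∈ E_S(ℚ)` (reducing to `Õ` mod `ℓ`, on the identity
component elsewhere) and an admissible auxiliary point `P'` (`P'`, `P' + P` not reducing to `Õ`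
mod `ℓ`), the residue `den x(P'+P) den x(P'+Q) · (den x(P') den x(P'+P+Q))⁻¹ ∈ (ℤ/ℓ)^×` — the
`ℓ`-component of `⟨P, Q⟩_S ∈ G_M = (ℤ/M)^×/±1`, squared (a canonical lift to `(ℤ/ℓ)^×`).  Defined for
all arguments (`⁻¹` is Mathlib's total inverse on `ZMod ℓ`; junk outside the admissible range).
[cite: MazurTate1987, Ch. II §3 (pp. 731–734) and p. 747]
[cite: PortilloBobadilla2019, §2.1 and §3.2] -/
def mazurTateTameSymbol (ℓ : ℕ) (P Q P' : V.toAffine.Point) : ZMod ℓ :=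
  ((xDen (P' + P) * xDen (P' + Q) : ℕ) : ZMod ℓ) * ((xDen P' * xDen (P' + P + Q) : ℕ) : ZMod ℓ)⁻¹

variable (V) in
/-- **The Mazur–Tate tame pairing read through a character of `(ℤ/ℓ)^×`**: `ψ(⟨P, Q⟩_ℓ) ∈ ℤ/m` for a
homomorphism `ψ : (ℤ/ℓ)^× → ℤ/m` (e.g. a discrete logarithm modulo `p^k ∣ ℓ - 1`, by which
`G_ℓ ⊗ ℤ/p^k = 𝔽_ℓ^× ⊗ ℤ/p^k` is identified with `ℤ/p^k` in Mazur–Tate's conjecture at a Kolyvagin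
prime; Burns–Kurihara–Sano 2021 §2.2 (4)–(5): `G_m^+ ↠ G ⊗ ℤ_p ≃ I/I²`); junk value `0` when the
symbol is not a unit (inadmissible auxiliary point). [cite: MazurTate1987, Ch. II §3 and p. 747]
[cite: BurnsKuriharaSano2021, §2.2 (4)–(6)] -/
def mazurTateTamePairing (ℓ : ℕ) {m : ℕ} (ψ : (ZMod ℓ)ˣ →* Multiplicative (ZMod m))
    (P Q P' : V.toAffine.Point) : ZMod m :=
  if h : IsUnit (mazurTateTameSymbol V ℓ P Q P') then Multiplicative.toAdd (ψ h.unit) else 0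

/-- Unfolding `mazurTateTamePairing` at an admissible configuration. [folklore] -/
theorem mazurTateTamePairing_of_isUnit (ℓ : ℕ) {m : ℕ} (ψ : (ZMod ℓ)ˣ →* Multiplicative (ZMod m))
    {P Q P' : V.toAffine.Point} (h : IsUnit (mazurTateTameSymbol V ℓ P Q P')) :
    mazurTateTamePairing V ℓ ψ P Q P' = Multiplicative.toAdd (ψ h.unit) := by
  rw [mazurTateTamePairing, dif_pos h]

/-- **The Mazur–Tate tame height is well defined by the `g`-formula (independence of the auxiliary
point).**  Mazur–Tate (1987, Ch. II §3, pp. 731–734) construct, for `E/ℚ` and a good prime `ℓ`,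
a canonical bi-multiplicative pairing `⟨ , ⟩_S : E(ℚ) × E_S(ℚ) → (ℤ/ℓ)^×/±1` (`S = {ℓ}`; `E_S(ℚ)` the
rational points reducing to `Õ` at `ℓ` and lying on the identity component at every prime), and
compute it (p. 747) by the function `g`; Portillo-Bobadilla (2019, §3.2, Proposition): *"If
`P ∈ E(ℚ)`, `Q ∈ E⁰(ℚ)`, then `g(P, Q, P', p)` does not depend on `P'` … the function `ĝ` … is
bi-multiplicative"*.  Stated for the SQUARE of `g` (`mazurTateTameSymbol`, a canonical lift of the
`±1`-ambiguous value): for a globally minimal `W/ℚ`, a prime `ℓ ∤ Δ_W`, `P ∈ E(ℚ)`, `Q ∈ E(ℚ)` with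
nonsingular reduction at every prime and reducing to `Õ` modulo `ℓ`, and two auxiliary points
`P', P''` such that none of `P', P' + P, P'', P'' + P` reduces to `Õ` modulo `ℓ`, the two values of
the symbol agree. [cite: MazurTate1987, Ch. II §3 (pp. 731–734) and p. 747]
[cite: PortilloBobadilla2019, §3.2 (Proposition: independence of P′, bi-multiplicativity)] -/
def MazurTate1987_tameSymbol_indep : Prop :=
  ∀ (W : WeierstrassCurve ℚ) [W.IsElliptic] [W.IsGloballyMinimal] (ℓ : ℕ) [Fact ℓ.Prime],
    ¬ (ℓ : ℤ) ∣ minimalDiscriminantInt W →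
    ∀ (P Q P' P'' : W.toAffine.Point),
      (∀ (q : ℕ) [Fact q.Prime], Q ∈ W.nonsingularReductionSubgroupAt q) →
      Q ∈ W.kernelOfReductionAt ℓ →
      P' ∉ W.kernelOfReductionAt ℓ → P' + P ∉ W.kernelOfReductionAt ℓ →
      P'' ∉ W.kernelOfReductionAt ℓ → P'' + P ∉ W.kernelOfReductionAt ℓ →
      mazurTateTameSymbol W ℓ P Q P' = mazurTateTameSymbol W ℓ P Q P''

end MazurTate

end Literature.NumberTheory.EllipticCurves
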